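import Literature.Computability.FineGrained.SETHHardness
import HarnessLib

/-!
# ETH-hardness of `k`-Clique: the position graph of a 3-CNF (the instance built on the word RAM)

The grouping reduction of Chen–Huang–Kanj–Xia (JCSS 72 (2006), Lemma 2.2 and Thm. 5.5: CLIQUE is
`Wₗ[1]`-hard) maps a 3-CNF `φ` with `m` clauses and a number `k` of groups to a graph on the
satisfying partial assignments of the `k` blocks of `b = ⌈m/k⌉` consecutive clauses, with a
`k`-clique iff `φ` is satisfiable (`hasKClique_compatGraph_chunks_iff_satisfiable` of
`…CliqueETH` is this statement for an abstract vertex type). The word-RAM program realising the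
reduction (the proof of the named fact `sparseKSATInRAMTime_of_kCliqueInTimeNLittleOK`) cannot
enumerate satisfying partial assignments as a vertex *type*; it numbers vertices arithmetically.
This file defines that numbering and proves it correct, in the exact Boolean form the program
computes:

* **slots** (`b = blockLen m k = m ⌈/⌉ k`): block `i` offers `3 b` slots, slot `t` being literal `t % 3` of clause `i b + t / 3`
  (`slotLit`); a vertex is a pair (block `i`, mask `μ < 2^{3b}`), numbered `a = i · 2^{3b} + μ`,
  the mask assigning a truth value to every slot;
* `conflictB` (two slots with the same variable but different bits), `goodB` (every clause of the
  block has a slot whose polarity equals its bit), and the adjacency `adjB` of the **position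
  graph**: different blocks, both endpoints self-consistent and good, no conflict between them;
* `posInstance φ k : CliqueInstance` (clique size `k`, `k · 2^{3b}` vertices, adjacency `adjB`) and
  its correctness **`hasKClique_posInstance_iff`**: for `k ≥ 2` and width `≤ 3`, the position
  instance has a `k`-clique iff `φ` is satisfiable (so `kClique.Good (posInstance φ k)` is
  `{[1]}` or `{[0]}` accordingly, `kClique_good_posInstance`);
* the word-level layout of the two encodings the program reads and writes: `encodeCNFWords φ`
  (`clauseStart`, `encodeCNFWords_getElem?_clauseStart(_succ)`, `length_encodeCNFWords_eq`) and
  `kClique.encode (posInstance φ k) = k :: N :: ⟨adjacency bits, row-major⟩`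
  (`kClique_encode_posInstance_getElem?_entry`, `inputWidth_kClique_encode_posInstance`:
  the input width is `Nat.size (N² + 2)`).

## References

* J. Chen, X. Huang, I. A. Kanj, G. Xia, *Strong computational lower bounds via parameterized
  complexity*, JCSS 72 (2006) 1346–1367, Lemma 2.2 (grouping) and Thm. 5.5.
* V. Vassilevska Williams, *On some fine-grained questions in algorithms and complexity*,
  Proc. ICM 2018, §2 (input conventions of the word RAM).
-/

namespace Literature.Computability.FineGrained

open Cryptography Cryptography.WordRAM Complexity



/-! ### Slots, conflicts, good blocks -/

section PosGraph

variable (φ : CNF ℕ) (b : ℕ)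

/-- The literal in *slot* `t` of block `i`: literal `t % 3` of clause `i * b + t / 3` (if any).
Blocks are the consecutive runs of `b` clauses; each clause of a 3-CNF offers three slots.
[folklore] -/
def slotLit (i t : ℕ) : Option (Literal ℕ) :=
  (φ[i * b + t / 3]?).bind fun cl : Clause ℕ => cl[t % 3]?

/-- Two (block, mask) pairs *conflict* if some slot of the first and some slot of the second carry
the same variable but the masks assign them different bits. [folklore] -/
def conflictB (i μ j ν : ℕ) : Bool :=
  (List.range (3 * b)).any fun t => (List.range (3 * b)).any fun u =>
    (slotLit φ b i t).isSome && ((slotLit φ b i t).map Prod.fst == (slotLit φ b j u).map Prod.fst) &&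
      (μ.testBit t != ν.testBit u)

/-- A (block, mask) pair is *good* if every clause of the block has a slot whose polarity is the
bit the mask assigns to it. [folklore] -/
def goodB (i μ : ℕ) : Bool :=
  (List.range b).all fun q => !decide (i * b + q < φ.length) ||
    (List.range 3).any fun l => (slotLit φ b i (3 * q + l)).map Prod.snd == some (μ.testBit (3 * q + l))

/-- The adjacency function of the **position graph** on vertex numbers `a = i * S + μ` (`S` the
number of masks per block): distinct blocks, both vertices good and self-consistent, and no
conflict between them. [folklore] -/
def adjB (S a a' : ℕ) : Bool :=
  (a / S != a' / S) && !conflictB φ b (a / S) (a % S) (a / S) (a % S) &&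
    !conflictB φ b (a' / S) (a' % S) (a' / S) (a' % S) &&
    !conflictB φ b (a / S) (a % S) (a' / S) (a' % S) && goodB φ b (a / S) (a % S) &&
    goodB φ b (a' / S) (a' % S)

variable {φ b}

/-- Unfolding `conflictB`. [folklore] -/
theorem conflictB_eq_true_iff (i μ j ν : ℕ) : conflictB φ b i μ j ν = true ↔
    ∃ t, t < 3 * b ∧ ∃ u, u < 3 * b ∧ ∃ l₁ l₂ : Literal ℕ, slotLit φ b i t = some l₁ ∧
      slotLit φ b j u = some l₂ ∧ l₁.1 = l₂.1 ∧ μ.testBit t ≠ ν.testBit u := by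
  simp only [conflictB, List.any_eq_true, List.mem_range, Bool.and_eq_true, Option.isSome_iff_exists,
    beq_iff_eq, bne_iff_ne, ne_eq]
  constructor
  · rintro ⟨t, ht, u, hu, ⟨⟨l₁, h₁⟩, hfst⟩, hne⟩
    rw [h₁] at hfst
    cases h₂ : slotLit φ b j u with
    | none => rw [h₂] at hfst; simp at hfst
    | some l₂ =>
      rw [h₂] at hfst
      simp only [Option.map_some, Option.some.injEq] at hfst
      exact ⟨t, ht, u, hu, l₁, l₂, h₁, h₂, hfst, hne⟩
  · rintro ⟨t, ht, u, hu, l₁, l₂, h₁, h₂, hfst, hne⟩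
    exact ⟨t, ht, u, hu, ⟨⟨l₁, h₁⟩, by rw [h₁, h₂]; simp [hfst]⟩, hne⟩

/-- `conflictB` is symmetric. [folklore] -/
theorem conflictB_comm (i μ j ν : ℕ) : conflictB φ b i μ j ν = conflictB φ b j ν i μ := by
  rw [Bool.eq_iff_iff, conflictB_eq_true_iff, conflictB_eq_true_iff]
  constructor
  · rintro ⟨t, ht, u, hu, l₁, l₂, h₁, h₂, hfst, hne⟩
    exact ⟨u, hu, t, ht, l₂, l₁, h₂, h₁, hfst.symm, fun h => hne h.symm⟩
  · rintro ⟨t, ht, u, hu, l₁, l₂, h₁, h₂, hfst, hne⟩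
    exact ⟨u, hu, t, ht, l₂, l₁, h₂, h₁, hfst.symm, fun h => hne h.symm⟩

/-- Unfolding `goodB`. [folklore] -/
theorem goodB_eq_true_iff (i μ : ℕ) : goodB φ b i μ = true ↔
    ∀ q, q < b → i * b + q < φ.length →
      ∃ l, l < 3 ∧ ∃ lit : Literal ℕ, slotLit φ b i (3 * q + l) = some lit ∧
        μ.testBit (3 * q + l) = lit.2 := by
  simp only [goodB, List.all_eq_true, List.mem_range, Bool.or_eq_true, Bool.not_eq_true',
    decide_eq_false_iff_not, List.any_eq_true, beq_iff_eq]
  constructor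
  · intro h q hq hlen
    rcases h q hq with h | ⟨l, hl, h⟩
    · exact absurd hlen h
    · cases hs : slotLit φ b i (3 * q + l) with
      | none => rw [hs] at h; simp at h
      | some lit =>
        rw [hs] at h
        simp only [Option.map_some, Option.some.injEq] at h
        exact ⟨l, hl, lit, hs, h.symm⟩
  · intro h q hq
    by_cases hlen : i * b + q < φ.length
    · obtain ⟨l, hl, lit, hs, hbit⟩ := h q hq hlen
      exact Or.inr ⟨l, hl, by rw [hs]; simp [hbit]⟩
    · exact Or.inl hlen

/-- `adjB` is symmetric. [folklore] -/
theorem adjB_comm (S a a' : ℕ) : adjB φ b S a a' = adjB φ b S a' a := by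
  simp only [adjB, conflictB_comm (a / S) (a % S) (a' / S) (a' % S)]
  rw [Bool.eq_iff_iff]
  simp only [Bool.and_eq_true, bne_iff_ne, ne_eq, Bool.not_eq_true']
  tauto

/-- `adjB` is irreflexive. [folklore] -/
theorem adjB_self (S a : ℕ) : adjB φ b S a a = false := by
  simp [adjB]

end PosGraph

/-! ### The position instance of `kClique` -/

/-- The block length `b = ⌈m / k⌉` for `m` clauses and `k` blocks, written `(m + k - 1) / k` as the
program computes it (this is Mathlib's `m ⌈/⌉ k`, `blockLen_eq_ceilDiv`, and the block length of
`CliqueETH.chunks`). [folklore] -/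
def blockLen (m k : ℕ) : ℕ := (m + k - 1) / k

/-- `blockLen` is the ceiling division `⌈/⌉`. [folklore] -/
theorem blockLen_eq_ceilDiv (m k : ℕ) : blockLen m k = m ⌈/⌉ k :=
  (Nat.ceilDiv_eq_add_pred_div m k).symm

/-- **The position instance**: clique size `k`, `k · 2^{3b}` vertices (`b = ⌈m/k⌉`), adjacency
`adjB`. [folklore] -/
def posInstance (φ : CNF ℕ) (k : ℕ) : CliqueInstance where
  k := k
  n := k * 2 ^ (3 * blockLen φ.length k)
  adj := fun a a' => adjB φ (blockLen φ.length k) (2 ^ (3 * blockLen φ.length k)) a a'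

/-- The adjacency of the position instance's graph is `adjB`. [folklore] -/
theorem adjMatrixGraph_posInstance_adj (φ : CNF ℕ) (k : ℕ) (a a' : Fin (posInstance φ k).n) :
    (adjMatrixGraph (posInstance φ k).adj).Adj a a' ↔
      adjB φ (blockLen φ.length k) (2 ^ (3 * blockLen φ.length k)) a a' = true := by
  simp only [adjMatrixGraph, SimpleGraph.fromRel_adj, posInstance]
  constructor
  · rintro ⟨-, h | h⟩
    · exact h
    · rwa [adjB_comm]
  · intro h
    refine ⟨fun haa => ?_, Or.inl h⟩
    subst haa; rw [adjB_self] at h; exact Bool.false_ne_true h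

/-- `b · k ≥ m` for `b = blockLen m k`, `0 < k`. [folklore] -/
theorem le_blockLen_mul {m k : ℕ} (hk : 0 < k) : m ≤ blockLen m k * k := by
  unfold blockLen
  have := Nat.lt_div_mul_add (a := m + k - 1) hk
  omega

/-- A clause index splits as block and offset. [folklore] -/
theorem div_blockLen_lt {m k q : ℕ} (hk : 0 < k) (hq : q < m) : q / blockLen m k < k := by
  have hb : 0 < blockLen m k := by
    unfold blockLen; exact Nat.div_pos (by omega) hk
  exact Nat.div_lt_of_lt_mul (lt_of_lt_of_le hq (le_blockLen_mul hk))


/-! ### Correctness of the position instance -/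

section Correctness

variable {φ : CNF ℕ} {b : ℕ}

/-- Unfolding `adjB`. [folklore] -/
theorem adjB_eq_true_iff (S a a' : ℕ) : adjB φ b S a a' = true ↔
    a / S ≠ a' / S ∧ conflictB φ b (a / S) (a % S) (a / S) (a % S) = false ∧
      conflictB φ b (a' / S) (a' % S) (a' / S) (a' % S) = false ∧
      conflictB φ b (a / S) (a % S) (a' / S) (a' % S) = false ∧
      goodB φ b (a / S) (a % S) = true ∧ goodB φ b (a' / S) (a' % S) = true := by
  simp [adjB, and_assoc]

/-- Slots are literals of clauses of `φ`: slot `3 q + l` of block `i` is literal `l` of clause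
`i * b + q`. [folklore] -/
theorem slotLit_three_mul_add (i q l : ℕ) (hl : l < 3) :
    slotLit φ b i (3 * q + l) = (φ[i * b + q]?).bind fun cl : Clause ℕ => cl[l]? := by
  unfold slotLit
  rw [Nat.mul_add_div (by norm_num), Nat.div_eq_of_lt hl, Nat.add_zero, Nat.mul_add_mod,
    Nat.mod_eq_of_lt hl]

/-- A slot literal belongs to a clause of `φ`. [folklore] -/
theorem exists_mem_of_slotLit {i t : ℕ} {lit : Literal ℕ} (h : slotLit φ b i t = some lit) :
    ∃ cl ∈ φ, lit ∈ cl := by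
  unfold slotLit at h
  cases hc : φ[i * b + t / 3]? with
  | none => rw [hc] at h; simp at h
  | some cl =>
    rw [hc, Option.bind_some] at h
    exact ⟨cl, List.mem_of_getElem? hc, List.mem_of_getElem? h⟩

/-- **Correctness of the position instance.** For `k ≥ 2` and a CNF of width `≤ 3`, the
position instance has a `k`-clique iff the CNF is satisfiable. (The grouping reduction of
Chen–Huang–Kanj–Xia, Lemma 2.2 / Thm. 5.5, in the slot form computed by the word-RAM program:
compare `hasKClique_compatGraph_chunks_iff_satisfiable`.) [folklore] -/
theorem hasKClique_posInstance_iff {k : ℕ} (hk : 2 ≤ k) (hw : φ.IsWidthLE 3) :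
    HasKClique (adjMatrixGraph (posInstance φ k).adj) (posInstance φ k).k ↔ φ.Satisfiable := by
  -- notation
  set m := φ.length with hm
  set b := blockLen m k with hb
  set S := 2 ^ (3 * b) with hS
  have hSpos : 0 < S := Nat.pow_pos (by norm_num)
  have hN : (posInstance φ k).n = k * S := rfl
  have hK : (posInstance φ k).k = k := rfl
  have hadj : ∀ a a' : Fin (posInstance φ k).n,
      (adjMatrixGraph (posInstance φ k).adj).Adj a a' ↔ adjB φ b S a a' = true :=
    adjMatrixGraph_posInstance_adj φ k
  rw [hK, hasKClique_iff]
  constructor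
  · -- from a clique to a satisfying assignment
    rintro ⟨s, hs⟩
    rw [SimpleGraph.isNClique_iff] at hs
    obtain ⟨hcl, hcard⟩ := hs
    have hblk_lt : ∀ a : Fin (posInstance φ k).n, (a : ℕ) / S < k := fun a =>
      Nat.div_lt_of_lt_mul (by rw [Nat.mul_comm]; exact hN ▸ a.2)
    -- adjacency facts inside the clique
    have hA : ∀ a ∈ s, ∀ a' ∈ s, a ≠ a' → adjB φ b S a a' = true := fun a ha a' ha' hne =>
      (hadj a a').1 (hcl ha ha' hne)
    -- every clique vertex has a neighbour in the clique (`k ≥ 2`)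
    have hnb : ∀ a ∈ s, ∃ a' ∈ s, a' ≠ a := fun a _ =>
      Finset.exists_mem_ne (by omega) a
    have hgood : ∀ a ∈ s, goodB φ b (a / S) (a % S) = true := by
      intro a ha
      obtain ⟨a', ha', hne⟩ := hnb a ha
      exact ((adjB_eq_true_iff S a a').1 (hA a ha a' ha' hne.symm)).2.2.2.2.1
    have hself : ∀ a ∈ s, conflictB φ b (a / S) (a % S) (a / S) (a % S) = false := by
      intro a ha
      obtain ⟨a', ha', hne⟩ := hnb a ha
      exact ((adjB_eq_true_iff S a a').1 (hA a ha a' ha' hne.symm)).2.1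
    -- blocks are hit
    have hinj : Set.InjOn (fun a : Fin (posInstance φ k).n => (a : ℕ) / S) s := by
      intro a ha a' ha' h
      by_contra hne
      exact ((adjB_eq_true_iff S a a').1 (hA a ha a' ha' hne)).1 h
    have himage : s.image (fun a : Fin (posInstance φ k).n => (a : ℕ) / S) = Finset.range k := by
      apply Finset.eq_of_subset_of_card_le
      · intro i hi
        simp only [Finset.mem_image] at hi
        obtain ⟨a, -, rfl⟩ := hi
        exact Finset.mem_range.2 (hblk_lt a)
      · rw [Finset.card_range, Finset.card_image_of_injOn hinj, hcard]
    have hhit : ∀ i, i < k → ∃ a ∈ s, (a : ℕ) / S = i := fun i hi => by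
      have : i ∈ s.image (fun a : Fin (posInstance φ k).n => (a : ℕ) / S) :=
        himage ▸ Finset.mem_range.2 hi
      simpa using this
    -- the glued assignment
    let τ : ℕ → Bool := fun v => decide (∃ a ∈ s, ∃ t, t < 3 * b ∧ ∃ lit : Literal ℕ,
      slotLit φ b (a / S) t = some lit ∧ lit.1 = v ∧ ((a : ℕ) % S).testBit t = true)
    have hτ : ∀ a ∈ s, ∀ t, t < 3 * b → ∀ lit : Literal ℕ, slotLit φ b (a / S) t = some lit →
        τ lit.1 = ((a : ℕ) % S).testBit t := by
      intro a ha t ht lit hlit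
      cases hbit : ((a : ℕ) % S).testBit t with
      | true =>
        simp only [τ, decide_eq_true_eq]
        exact ⟨a, ha, t, ht, lit, hlit, rfl, hbit⟩
      | false =>
        simp only [τ, decide_eq_false_iff_not, not_exists, not_and]
        intro a' ha' u hu lit' hlit' hvar hbit'
        by_cases haa : a' = a
        · rw [haa] at hlit' hbit'
          have : conflictB φ b (a / S) (a % S) (a / S) (a % S) = true :=
            (conflictB_eq_true_iff _ _ _ _).2 ⟨t, ht, u, hu, lit, lit', hlit, hlit', hvar.symm,
              by rw [hbit, hbit']; decide⟩
          rw [hself a ha] at this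
          exact Bool.false_ne_true this
        · have hadj' := (adjB_eq_true_iff S a a').1 (hA a ha a' ha' (Ne.symm haa))
          have : conflictB φ b (a / S) (a % S) (a' / S) (a' % S) = true :=
            (conflictB_eq_true_iff _ _ _ _).2 ⟨t, ht, u, hu, lit, lit', hlit, hlit', hvar.symm,
              by rw [hbit, hbit']; decide⟩
          rw [hadj'.2.2.2.1] at this
          exact Bool.false_ne_true this
    refine ⟨τ, (CNF.eval_eq_true_iff φ τ).2 fun cl hcl => ?_⟩
    -- the clause `cl = φ[q]` lies in block `q / b`
    obtain ⟨q, hq, hqcl⟩ := List.getElem_of_mem hcl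
    have hb0 : 0 < b := by rw [hb]; unfold blockLen; exact Nat.div_pos (by omega) (by omega)
    have hi : q / b < k := div_blockLen_lt (by omega) hq
    obtain ⟨a, ha, hai⟩ := hhit (q / b) hi
    have hq' : q % b < b := Nat.mod_lt _ hb0
    have hqq : q / b * b + q % b = q := Nat.div_add_mod' q b
    obtain ⟨l, hl, lit, hlit, hbit⟩ :=
      (goodB_eq_true_iff _ _).1 (hgood a ha) (q % b) hq' (by rw [hai, hqq]; exact hq)
    rw [hai] at hlit
    have hlit' : cl[l]? = some lit := by
      rw [slotLit_three_mul_add _ _ _ hl, hqq] at hlit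
      have hφq : φ[q]? = some cl := by rw [List.getElem?_eq_getElem hq, hqcl]
      rwa [hφq, Option.bind_some] at hlit
    simp only [Clause.eval, List.any_eq_true]
    refine ⟨lit, List.mem_of_getElem? hlit', ?_⟩
    simp only [Literal.eval, beq_iff_eq]
    rw [← hai] at hlit
    rw [hτ a ha (3 * (q % b) + l) (by omega) lit hlit, hbit]
  · -- from a satisfying assignment to a clique
    rintro ⟨σ, hσ⟩
    rw [CNF.eval_eq_true_iff] at hσ
    let bits : ℕ → ℕ → Bool := fun i t =>
      match slotLit φ b i t with
      | some lit => σ lit.1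
      | none => false
    let μ : ℕ → ℕ := fun i => Nat.ofBits fun t : Fin (3 * b) => bits i t
    have hμS : ∀ i, μ i < S := fun i => Nat.ofBits_lt_two_pow _
    have hμbit : ∀ i t, t < 3 * b → ∀ lit : Literal ℕ, slotLit φ b i t = some lit →
        (μ i).testBit t = σ lit.1 := by
      intro i t ht lit hlit
      simp only [μ, Nat.testBit_ofBits_lt _ _ ht, bits]
      rw [hlit]
    have hvert_lt : ∀ i, i < k → i * S + μ i < (posInstance φ k).n := fun i hi => by
      rw [hN]
      have := hμS i
      calc i * S + μ i < i * S + S := by omega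
        _ = (i + 1) * S := by ring
        _ ≤ k * S := Nat.mul_le_mul_right _ hi
    let vert : Fin k → Fin (posInstance φ k).n := fun i => ⟨i * S + μ i, hvert_lt i i.2⟩
    have hdiv : ∀ i : Fin k, ((vert i : Fin _) : ℕ) / S = i := fun i => by
      show ((i : ℕ) * S + μ i) / S = i
      rw [Nat.mul_comm, Nat.mul_add_div hSpos, Nat.div_eq_of_lt (hμS i), Nat.add_zero]
    have hmod : ∀ i : Fin k, ((vert i : Fin _) : ℕ) % S = μ i := fun i => by
      show ((i : ℕ) * S + μ i) % S = μ i
      rw [Nat.mul_comm, Nat.mul_add_mod, Nat.mod_eq_of_lt (hμS i)]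
    -- no conflicts among the `(i, μ i)`
    have hnoconf : ∀ i j, conflictB φ b i (μ i) j (μ j) = false := by
      intro i j
      rw [Bool.eq_false_iff]
      intro h
      obtain ⟨t, ht, u, hu, l₁, l₂, h₁, h₂, hvar, hne⟩ := (conflictB_eq_true_iff _ _ _ _).1 h
      rw [hμbit i t ht l₁ h₁, hμbit j u hu l₂ h₂, hvar] at hne
      exact hne rfl
    -- every `(i, μ i)` is good
    have hgood : ∀ i, goodB φ b i (μ i) = true := by
      intro i
      rw [goodB_eq_true_iff]
      intro q hq hlen
      have hcl : φ[i * b + q] ∈ φ := List.getElem_mem hlen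
      obtain ⟨lit, hlit, hval⟩ : ∃ lit ∈ φ[i * b + q], Literal.eval σ lit = true := by
        have := hσ _ hcl
        simpa [Clause.eval, List.any_eq_true] using this
      obtain ⟨l, hl, hll⟩ := List.getElem_of_mem hlit
      have hl3 : l < 3 := lt_of_lt_of_le hl (hw _ hcl)
      have hslot : slotLit φ b i (3 * q + l) = some lit := by
        rw [slotLit_three_mul_add _ _ _ hl3, List.getElem?_eq_getElem hlen, Option.bind_some,
          List.getElem?_eq_getElem hl, hll]
      refine ⟨l, hl3, lit, hslot, ?_⟩
      rw [hμbit i _ (by omega) lit hslot]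
      simpa [Literal.eval] using hval
    have hinj : Function.Injective vert := by
      intro i j h
      have := congrArg (fun a : Fin (posInstance φ k).n => (a : ℕ) / S) h
      simp only [hdiv] at this
      exact Fin.ext this
    refine ⟨Finset.univ.image vert, ?_⟩
    rw [SimpleGraph.isNClique_iff]
    refine ⟨?_, by rw [Finset.card_image_of_injective _ hinj, Finset.card_univ, Fintype.card_fin]⟩
    intro x hx y hy hxy
    simp only [Finset.coe_image, Finset.coe_univ, Set.image_univ, Set.mem_range] at hx hy
    obtain ⟨i, rfl⟩ := hx
    obtain ⟨j, rfl⟩ := hy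
    have hij : (i : ℕ) ≠ j := fun h => hxy (by rw [Fin.ext h])
    rw [hadj, adjB_eq_true_iff, hdiv, hdiv, hmod, hmod]
    exact ⟨hij, hnoconf i i, hnoconf j j, hnoconf i j, hgood i, hgood j⟩

end Correctness




/-! ### The clause layout of `encodeCNFWords` -/

/-- The code of a literal in `encodeCNFWords`: `2 · var + polarity`. [folklore] -/
def litCode (l : Literal ℕ) : ℕ := 2 * l.1 + l.2.toNat

/-- The block of words of a clause in `encodeCNFWords`: its length, then its literal codes.
[folklore] -/
def clauseWords (c : Clause ℕ) : List ℕ := c.length :: c.map litCode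

/-- `encodeCNFWords` is the header `[numVars, numClauses]` followed by the clause blocks.
[folklore] -/
theorem encodeCNFWords_eq (φ : CNF ℕ) :
    encodeCNFWords φ = φ.numVars :: φ.numClauses :: φ.flatMap clauseWords := rfl

/-- The position of the block of clause `q` in `encodeCNFWords φ`: `2 +` the total size of the
preceding blocks. [folklore] -/
def clauseStart (φ : CNF ℕ) (q : ℕ) : ℕ :=
  2 + ((φ.take q).map fun c => c.length + 1).sum

/-- Indexing into a concatenation of blocks: position `(sizes of the first q blocks) + j` of
`flatMap f l` is position `j` of block `f l[q]`. [folklore] -/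
theorem getElem?_flatMap_blocks {α : Type*} (f : α → List ℕ) :
    ∀ (l : List α) (q : ℕ) (hq : q < l.length) (j : ℕ), j < (f l[q]).length →
      (l.flatMap f)[((l.take q).map fun a => (f a).length).sum + j]? = (f l[q])[j]?
  | [], q, hq, _, _ => by simp at hq
  | a :: l, 0, _, j, hj => by
    simp only [List.take_zero, List.map_nil, List.sum_nil, Nat.zero_add, List.flatMap_cons,
      List.getElem_cons_zero] at hj ⊢
    rw [List.getElem?_append_left hj]
  | a :: l, q + 1, hq, j, hj => by
    simp only [List.take_succ_cons, List.map_cons, List.sum_cons, List.flatMap_cons,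
      List.getElem_cons_succ]
    rw [Nat.add_assoc, List.getElem?_append_right (by omega), Nat.add_sub_cancel_left]
    exact getElem?_flatMap_blocks f l q (by simpa using hq) j (by simpa using hj)

/-- Word `0` of the encoding is `numVars`. [folklore] -/
theorem encodeCNFWords_getElem?_zero (φ : CNF ℕ) : (encodeCNFWords φ)[0]? = some φ.numVars := rfl

/-- Word `1` of the encoding is `numClauses`. [folklore] -/
theorem encodeCNFWords_getElem?_one (φ : CNF ℕ) : (encodeCNFWords φ)[1]? = some φ.numClauses := rfl

/-- The word at `clauseStart φ q` is the length of clause `q`. [folklore] -/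
theorem encodeCNFWords_getElem?_clauseStart (φ : CNF ℕ) {q : ℕ} (hq : q < φ.length) :
    (encodeCNFWords φ)[clauseStart φ q]? = some φ[q].length := by
  rw [encodeCNFWords_eq, clauseStart, show 2 + ((φ.take q).map fun c => c.length + 1).sum =
    ((φ.take q).map fun c => (clauseWords c).length).sum + 0 + 1 + 1 by simp [clauseWords]; ring]
  rw [List.getElem?_cons_succ, List.getElem?_cons_succ]
  have := getElem?_flatMap_blocks clauseWords φ q hq 0 (by simp [clauseWords])
  rw [Nat.add_zero] at this
  rw [this]
  simp [clauseWords]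

/-- The word at `clauseStart φ q + 1 + l` is the code of literal `l` of clause `q`. [folklore] -/
theorem encodeCNFWords_getElem?_clauseStart_succ (φ : CNF ℕ) {q : ℕ} (hq : q < φ.length) {l : ℕ}
    (hl : l < φ[q].length) :
    (encodeCNFWords φ)[clauseStart φ q + 1 + l]? = some (litCode φ[q][l]) := by
  rw [encodeCNFWords_eq, clauseStart, show 2 + ((φ.take q).map fun c => c.length + 1).sum + 1 + l =
    ((φ.take q).map fun c => (clauseWords c).length).sum + (l + 1) + 1 + 1 by simp [clauseWords]; ring]
  rw [List.getElem?_cons_succ, List.getElem?_cons_succ,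
    getElem?_flatMap_blocks clauseWords φ q hq (l + 1) (by simp [clauseWords]; omega)]
  simp [clauseWords, hl]

/-- The next clause starts after the block of clause `q`. [folklore] -/
theorem clauseStart_succ (φ : CNF ℕ) {q : ℕ} (hq : q < φ.length) :
    clauseStart φ (q + 1) = clauseStart φ q + 1 + φ[q].length := by
  unfold clauseStart
  rw [List.take_add_one, List.getElem?_eq_getElem hq]
  simp only [Option.toList_some, List.map_append, List.map_cons, List.map_nil, List.sum_append,
    List.sum_cons, List.sum_nil]
  omega

/-- `clauseStart φ 0 = 2`. [folklore] -/
@[simp] theorem clauseStart_zero (φ : CNF ℕ) : clauseStart φ 0 = 2 := by simp [clauseStart]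

/-- The encoding has length `clauseStart φ m` (`m` the number of clauses). [folklore] -/
theorem length_encodeCNFWords (φ : CNF ℕ) : (encodeCNFWords φ).length = clauseStart φ φ.length := by
  rw [encodeCNFWords_eq, clauseStart, List.take_length]
  simp only [List.length_cons, List.length_flatMap]
  have : (φ.map fun a => (clauseWords a).length) = φ.map fun c => c.length + 1 := by
    apply List.map_congr_left; intro c _; simp [clauseWords]
  rw [this]; omega

/-- `clauseStart` is monotone. [folklore] -/
theorem clauseStart_mono (φ : CNF ℕ) {q q' : ℕ} (h : q ≤ q') : clauseStart φ q ≤ clauseStart φ q' := by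
  unfold clauseStart
  obtain ⟨d, rfl⟩ := Nat.exists_eq_add_of_le h
  rw [List.take_add, List.map_append, List.sum_append]
  omega

/-- Every clause block lies inside the encoding. [folklore] -/
theorem clauseStart_add_length_le (φ : CNF ℕ) {q : ℕ} (hq : q < φ.length) :
    clauseStart φ q + 1 + φ[q].length ≤ (encodeCNFWords φ).length := by
  rw [length_encodeCNFWords, ← clauseStart_succ φ hq]
  exact clauseStart_mono φ hq

/-- The encoding has length `2 + m + size`. [folklore] -/
theorem length_encodeCNFWords_eq (φ : CNF ℕ) :
    (encodeCNFWords φ).length = 2 + φ.numClauses + φ.size := by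
  rw [length_encodeCNFWords, clauseStart, List.take_length, CNF.numClauses, CNF.size]
  induction φ with
  | nil => simp
  | cons c φ ih =>
    simp only [List.map_cons, List.sum_cons, List.length_cons] at ih ⊢
    omega


/-! ### The `kClique` encoding of the position instance -/

/-- The clique size of the position instance. [folklore] -/
@[simp] theorem posInstance_k (φ : CNF ℕ) (k : ℕ) : (posInstance φ k).k = k := rfl

/-- The vertex number `N = k · 2^{3b}` of the position instance. [folklore] -/
@[simp] theorem posInstance_n (φ : CNF ℕ) (k : ℕ) :
    (posInstance φ k).n = k * 2 ^ (3 * blockLen φ.length k) := rfl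

/-- `k ≤ N`: there are at least as many vertices as blocks. [folklore] -/
theorem le_posInstance_n (φ : CNF ℕ) (k : ℕ) : k ≤ (posInstance φ k).n :=
  Nat.le_mul_of_pos_right _ (Nat.pow_pos (by norm_num))

/-- Indexing into a concatenation of blocks of a common length `n`: position `q n + j` of
`flatMap f l` is position `j` of block `f l[q]`. [folklore] -/
theorem getElem?_flatMap_const {α : Type*} (f : α → List ℕ) {n : ℕ} :
    ∀ (l : List α), (∀ a ∈ l, (f a).length = n) → ∀ (q : ℕ) (hq : q < l.length) (j : ℕ), j < n →
      (l.flatMap f)[q * n + j]? = (f l[q])[j]?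
  | [], _, q, hq, _, _ => by simp at hq
  | a :: l, hl, 0, _, j, hj => by
    simp only [Nat.zero_mul, Nat.zero_add, List.flatMap_cons, List.getElem_cons_zero]
    rw [List.getElem?_append_left (by rw [hl a (by simp)]; exact hj)]
  | a :: l, hl, q + 1, hq, j, hj => by
    simp only [List.flatMap_cons, List.getElem_cons_succ]
    rw [Nat.succ_mul, show q * n + n + j = n + (q * n + j) by ring,
      List.getElem?_append_right (by rw [hl a (by simp)]; omega), hl a (by simp),
      Nat.add_sub_cancel_left]
    exact getElem?_flatMap_const f l (fun b hb => hl b (by simp [hb])) q (by simpa using hq) j hj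

/-- Word `0` of an encoded Boolean matrix is its dimension. [folklore] -/
theorem encodeBoolMatrix_getElem?_zero {n : ℕ} (A : Matrix (Fin n) (Fin n) Bool) :
    (encodeBoolMatrix A)[0]? = some n := rfl

/-- Word `1 + (i n + j)` of an encoded Boolean matrix is the entry `A i j` as `0`/`1`.
[folklore] -/
theorem encodeBoolMatrix_getElem?_entry {n : ℕ} (A : Matrix (Fin n) (Fin n) Bool) (i j : Fin n) :
    (encodeBoolMatrix A)[1 + (i * n + j)]? = some (A i j).toNat := by
  unfold encodeBoolMatrix
  rw [Nat.add_comm, List.getElem?_cons_succ,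
    getElem?_flatMap_const _ (List.finRange n) (fun a _ => by simp) i (by simp) j j.2]
  simp

/-- Every word of an encoded Boolean matrix is at most `max n 1`. [folklore] -/
theorem le_of_mem_encodeBoolMatrix {n : ℕ} (A : Matrix (Fin n) (Fin n) Bool) {v : ℕ}
    (hv : v ∈ encodeBoolMatrix A) : v ≤ max n 1 := by
  simp only [encodeBoolMatrix, List.mem_cons, List.mem_flatMap, List.mem_map] at hv
  rcases hv with rfl | ⟨i, -, j, -, rfl⟩
  · exact le_max_left _ _
  · exact (Bool.toNat_le _).trans (le_max_right _ _)

/-- The `kClique` encoding of the position instance: `k`, then the encoded adjacency matrix.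
[folklore] -/
theorem kClique_encode_posInstance (φ : CNF ℕ) (k : ℕ) :
    kClique.encode (posInstance φ k) = k :: encodeBoolMatrix (posInstance φ k).adj := rfl

/-- The `kClique` encoding of the position instance has length `N² + 2`. [folklore] -/
theorem length_kClique_encode_posInstance (φ : CNF ℕ) (k : ℕ) :
    (kClique.encode (posInstance φ k)).length = (posInstance φ k).n ^ 2 + 2 := by
  rw [kClique_encode_posInstance, List.length_cons, encodeBoolMatrix_length]

/-- Word `0` of the encoding is `k`. [folklore] -/
theorem kClique_encode_posInstance_getElem?_zero (φ : CNF ℕ) (k : ℕ) :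
    (kClique.encode (posInstance φ k))[0]? = some k := rfl

/-- Word `1` of the encoding is `N`. [folklore] -/
theorem kClique_encode_posInstance_getElem?_one (φ : CNF ℕ) (k : ℕ) :
    (kClique.encode (posInstance φ k))[1]? = some (posInstance φ k).n := rfl

/-- Word `2 + (a N + a')` of the encoding is the adjacency bit `adjB φ b 2^{3b} a a'`. [folklore] -/
theorem kClique_encode_posInstance_getElem?_entry (φ : CNF ℕ) (k : ℕ) {a a' : ℕ}
    (ha : a < (posInstance φ k).n) (ha' : a' < (posInstance φ k).n) :
    (kClique.encode (posInstance φ k))[2 + (a * (posInstance φ k).n + a')]? =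
      some (adjB φ (blockLen φ.length k) (2 ^ (3 * blockLen φ.length k)) a a').toNat := by
  rw [kClique_encode_posInstance, show 2 + (a * (posInstance φ k).n + a') =
    (1 + (a * (posInstance φ k).n + a')) + 1 by ring, List.getElem?_cons_succ,
    encodeBoolMatrix_getElem?_entry _ ⟨a, ha⟩ ⟨a', ha'⟩]
  rfl

/-- Every word of the encoding is at most `max N 1` (for `k ≤ N`). [folklore] -/
theorem le_of_mem_kClique_encode_posInstance (φ : CNF ℕ) (k : ℕ) {v : ℕ}
    (hv : v ∈ kClique.encode (posInstance φ k)) : v ≤ max (posInstance φ k).n 1 := by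
  rw [kClique_encode_posInstance, List.mem_cons] at hv
  rcases hv with rfl | hv
  · exact (le_posInstance_n φ v).trans (le_max_left _ _)
  · exact le_of_mem_encodeBoolMatrix _ hv

/-- The maximum word of a list, with floor `1`, is at most any bound `≥ 1` of its members.
[folklore] -/
theorem foldr_max_one_le {l : List ℕ} {B : ℕ} (h1 : 1 ≤ B) (h : ∀ v ∈ l, v ≤ B) :
    l.foldr max 1 ≤ B := by
  induction l with
  | nil => exact h1
  | cons a l ih =>
    simp only [List.foldr_cons, max_le_iff]
    exact ⟨h a (by simp), ih fun v hv => h v (by simp [hv])⟩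

/-- **The input width of the position instance** is `Nat.size (N² + 2)`: the length `N² + 2` of the
encoding dominates every word (`k ≤ N ≤ N² + 2`, bits `≤ 1`). [folklore] -/
theorem inputWidth_kClique_encode_posInstance (φ : CNF ℕ) (k : ℕ) :
    inputWidth (kClique.encode (posInstance φ k)) = Nat.size ((posInstance φ k).n ^ 2 + 2) := by
  unfold inputWidth
  rw [length_kClique_encode_posInstance, max_eq_left]
  refine foldr_max_one_le (by omega) fun v hv => (le_of_mem_kClique_encode_posInstance φ k hv).trans ?_
  refine max_le ?_ (by omega)
  nlinarith [Nat.zero_le (posInstance φ k).n]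

/-- The width of the position instance as a `kClique` instance. [folklore] -/
theorem kClique_width_posInstance (φ : CNF ℕ) (k : ℕ) :
    kClique.width (posInstance φ k) = Nat.size ((posInstance φ k).n ^ 2 + 2) :=
  inputWidth_kClique_encode_posInstance φ k

open scoped Classical in
/-- **The accepted output on the position instance** (`k ≥ 2`, width `≤ 3`): `[1]` if `φ` is
satisfiable, `[0]` otherwise. [folklore] -/
theorem kClique_good_posInstance {φ : CNF ℕ} {k : ℕ} (hk : 2 ≤ k) (hw : φ.IsWidthLE 3) :
    kClique.Good (posInstance φ k) = {[if φ.Satisfiable then 1 else 0]} := by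
  change (if HasKClique (adjMatrixGraph (posInstance φ k).adj) (posInstance φ k).k then {[1]}
    else {[0]} : Set (List ℕ)) = _
  rw [hasKClique_posInstance_iff hk hw]
  by_cases h : φ.Satisfiable <;> simp [h]

/-- The size of the position instance as a `kClique` instance is `N`. [folklore] -/
theorem kClique_size_posInstance (φ : CNF ℕ) (k : ℕ) :
    kClique.size (posInstance φ k) = (posInstance φ k).n := rfl

/-! ### Size of the position instance for sparse formulas -/

/-- The block length is at most `m / k + 1`. [folklore] -/
theorem blockLen_le (m : ℕ) {k : ℕ} (hk : 0 < k) : blockLen m k ≤ m / k + 1 := by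
  unfold blockLen
  calc (m + k - 1) / k ≤ (m + k) / k := Nat.div_le_div_right (Nat.sub_le _ _)
    _ = m / k + 1 := by rw [Nat.add_div_right _ hk]

/-- For a formula with `m ≤ c n` clauses, `b ≤ c n / k + 1`. [folklore] -/
theorem blockLen_le_of_sparse {m c n k : ℕ} (hk : 0 < k) (hm : m ≤ c * n) :
    blockLen m k ≤ c * n / k + 1 :=
  (blockLen_le m hk).trans (Nat.add_le_add_right (Nat.div_le_div_right hm) 1)

end Literature.Computability.FineGrained
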